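import Summits.CriticalPhenomena.PercolationContinuityZ3.Theorems.Transplant.GrigorchukPowerWitnessConj4Defs
import HarnessLib

/-!
# W4 — the nc Hara–Slade line on `Cay(𝔊^k; std)`: the VOCABULARY of the registered skeleton (DEFS-A: §1 of the W4 skeleton of record v1.1 98f98c28)

Definitions file (`--supports stmt-CriticalPhenomena-4575 --as helper`, kind definition), lane `prim-bschramm`, seat `prim-bschramm-gen-1` gen 12 (GEN pen); item
E4.0 DEFS-A of the lead's allocation (lead g29, bus 2026-08-29 #9731) on the W4 SKELETON OF RECORD «HOME/w-ideation/W4/NcHaraSladeGk_birth.lean» (v1 19af006b →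
v1.1 98f98c28, HOME/wake/W-LEDGER.md 06:35Z / 06:50Z; director-frontier g15 RULING W4-REGISTRATION #9712; design desk p3 g42), def list + binder shapes = the design
desk's one-line spec (p3 g42 #9733).  ONE HOME for the W4 vocabulary: every later stub file (E4.1 `smallParam_holds`, E4.2 `uniformPolygons_holds`, S1, S3a/S3b,
trace monotonicity, and the composition file, which lands LAST) imports THIS file, and the skeleton's local copies of §1 retire at composition time.
builds on p205010 (kernel theorem, internal audit signed; external expert review pending) — nothing here uses p205010.

CONTENT = §1 of the skeleton VERBATIM (same names, same bodies) — `conn`, `triangle`, `lazyStep`, `simpleStep`, `twoPointForm`, `greenForm`, `OperatorIRBound`,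
`rwPolygon`, `TriangleCond`, `TraceMonotonicity`, `TriangleDoorGk` — with the THREE BINDER REPAIRS of rule :517 (no parameterless cited Prop-def; NO semantic
change, the skeleton reads them through `∀`/`∃` — p3 g42 #9733 b1–b3): `UniformPolygons (q : ℕ)` (skeleton: `∀ q, UniformPolygons q`), `SmallParam (A : ℝ)`
(skeleton: `∃ A, SmallParam A`), `NcHaraSladeGk (k₀ : ℕ)` (skeleton: `∃ k₀, NcHaraSladeGk k₀`), plus a tiny PROVED API (`conn_comm`, `conn_nonneg`, `conn_le_one`,
`lazyStep_zero`, `simpleStep_zero`).  NOT here (DEFS-B, homed with S1/S3 when staffed): the bootstrap function `fBoot`/`fTwo`/`OIRBAt`/`pcR`, the lace objects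
`tauFun`/`IsLaceKernel`/`omegaV`/`kappa0`/`laceNormE`/`laceBound`; NOT here either: the skeleton's tail `gkCay_conj4_eventually` or any theorem with a hypothesis
that has no honest instance (R-T5-1).  No instance, no notation, no sorry, NO `@[conjecture]`: every `Prop` here is a HYPOTHESIS SHAPE or a door; NOTHING is asserted —
in particular NOTHING here claims `θ(p_c) = 0` on any `Cay(𝔊^k)`, the operator infrared bound on any `Cay(𝔊^k)`, or the triangle condition; `gkCay_conj4 k`
(@[conjecture], p682559), the residue node and `…conj4_endState` stay OPEN.  NORMALISATION (skeleton header, w-crit-1 N2 / p5 N-a): every constant is w.r.t. the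
LAZY Green form `𝒢_L = 2𝒢`, so `OperatorIRBound G 3` here is `OIRB_6` w.r.t. `𝒢`.
[cite: HeydenreichVanDerHofstad2017, §1.1–§1.2 (two-point function, infrared bound), §4.1 (triangle condition), §5.2 (random-walk diagrams), §8.1 (bootstrap)]
[cite: FackKosaki1986, Lemma 2.5 (iii)] [cite: BarskyAizenman1991, Thm. 1.1] [cite: HaraSlade1990, Thm. 1.1] [cite: BenjaminiSchramm1996, §2 and Conj. 4]
-/

noncomputable section

namespace Summit.CriticalPhenomena.PercolationContinuityZ3.Theorems.Transplant

namespace Grigorchuk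

namespace NcHaraSlade

open SimpleGraph MeasureTheory Literature.Probability.Percolation Literature.Barriers.CriticalPhenomena
open scoped ENNReal Classical

variable {V : Type}

/-! ## §1 Two-point function, diagrams, walk kernels, quadratic forms -/

/-- The two-point function `τ_p(x, y) = P_p(x ↔ y)` (as `P_p(y ∈ C(x))`). [cite: HeydenreichVanDerHofstad2017, §1.1 (the two-point function)] -/
def conn (G : SimpleGraph V) (p : unitInterval) (x y : V) : ℝ :=
  (bondPercolation G p).real {ω | y ∈ openCluster ω x}

/-- The triangle diagram `∇_v(p) = Σ_{x,y} τ(v,x) τ(x,y) τ(y,v) ∈ [0, ∞]`. [cite: HeydenreichVanDerHofstad2017, §4.1 (triangle condition)] -/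
def triangle (G : SimpleGraph V) (v : V) (p : unitInterval) : ℝ≥0∞ :=
  ∑' x : V, ∑' y : V, ENNReal.ofReal (conn G p v x * conn G p x y * conn G p y v)

/-- `n`-step kernel of the LAZY simple random walk `P_L = (1 + P)/2 ≽ 0` (comparison Green operator `𝒢_L = (1 − P_L)^{-1} = 2𝒢`). [cite: HeydenreichVanDerHofstad2017, §5.2 (random-walk quantities)] -/
def lazyStep (G : SimpleGraph V) [G.LocallyFinite] : ℕ → V → V → ℝ
  | 0, x, y => if x = y then 1 else 0
  | n + 1, x, y => (1 / 2 : ℝ) * lazyStep G n x y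
      + (1 / 2 : ℝ) * ∑ z ∈ G.neighborFinset x, (1 / (G.degree x : ℝ)) * lazyStep G n z y

/-- `n`-step kernel of the SIMPLE random walk `U = (1/|S|) Σ_s ρ(s)` (the small parameter `p₄(e,e)` lives here). [cite: HeydenreichVanDerHofstad2017, §5.2 (random-walk quantities)] -/
def simpleStep (G : SimpleGraph V) [G.LocallyFinite] : ℕ → V → V → ℝ
  | 0, x, y => if x = y then 1 else 0
  | n + 1, x, y => ∑ z ∈ G.neighborFinset x, (1 / (G.degree x : ℝ)) * simpleStep G n z y

/-- The quadratic form of the two-point function on a finitely supported test function, `⟨f, λ(τ_p) f⟩ = Σ_{x,y} f(x) f(y) τ_p(x, y)`.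
[cite: HeydenreichVanDerHofstad2017, §1.2 (infrared bound)] -/
def twoPointForm (G : SimpleGraph V) (p : unitInterval) (f : V →₀ ℝ) : ℝ :=
  ∑ x ∈ f.support, ∑ y ∈ f.support, f x * f y * conn G p x y

/-- The lazy Green form `⟨f, 𝒢_L f⟩ = Σ_n ⟨f, P_L^n f⟩ ∈ [0, ∞]`. [cite: HeydenreichVanDerHofstad2017, §1.2 (infrared bound), §5.2] -/
def greenForm (G : SimpleGraph V) [G.LocallyFinite] (f : V →₀ ℝ) : ℝ≥0∞ :=
  ∑' n : ℕ, ENNReal.ofReal (∑ x ∈ f.support, ∑ y ∈ f.support, f x * f y * lazyStep G n x y)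

/-- **`OIRB_C(G)` — the OPERATOR INFRARED BOUND** `λ(τ_p) ≼ C · 𝒢_L` as quadratic forms on finitely supported functions, uniformly in `p < p_c(G, v)` (every `v`).
A hypothesis shape; nothing asserted (the k-space infrared bound of the source, transplanted to operators — no proof on any `Cay(𝔊^k)` exists).
[cite: HeydenreichVanDerHofstad2017, §1.2 (infrared bound)] [cite: HaraSlade1990, Thm. 1.1 (context)] -/
def OperatorIRBound (G : SimpleGraph V) [G.LocallyFinite] (C : ℝ≥0∞) : Prop :=
  ∀ v : V, ∀ p : unitInterval, (p : ℝ) < criticalProb G v → ∀ f : V →₀ ℝ,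
    ENNReal.ofReal (twoPointForm G p f) ≤ C * greenForm G f

/-- The random-walk polygon `G_q^L(v) = ⟨δ_v, 𝒢_L^q δ_v⟩ = Σ_n C(n+q−1, q−1) p^L_n(v, v) ∈ [0, ∞]` (`q = 3`: the walk triangle).  ℕ-subtraction quirk kept from
the skeleton: `q = 0` reads as `q = 1` (`C(n−1, −1)` is computed as `C(n−1, 0) = 1`) — harmless, `q = 0` is never consumed. [cite: HeydenreichVanDerHofstad2017, §5.2 (random-walk diagrams)] -/
def rwPolygon (q : ℕ) (G : SimpleGraph V) [G.LocallyFinite] (v : V) : ℝ≥0∞ :=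
  ∑' n : ℕ, ENNReal.ofReal ((Nat.choose (n + q - 1) (q - 1) : ℝ) * lazyStep G n v v)

/-- **The triangle condition** (uniform triangle bound below `p_c`): `∀ v, ∃ B < ∞, ∀ p < p_c(G, v), ∇_v(p) ≤ B`.  A hypothesis shape; nothing asserted.
[cite: HeydenreichVanDerHofstad2017, §4.1 (triangle condition)] -/
def TriangleCond (G : SimpleGraph V) : Prop :=
  ∀ v : V, ∃ B : ℝ≥0∞, B < ⊤ ∧ ∀ p : unitInterval, (p : ℝ) < criticalProb G v → triangle G v p ≤ B

/-- **Trace monotonicity** (support item P1): `0 ≼ λ(τ_p) ≼ C 𝒢_L ⇒ ∇_v(p) ≤ C³ · G_3^L(v)` — monotonicity of the von Neumann trace of cubes in the group von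
Neumann algebra (Fack–Kosaki).  A hypothesis shape here (the W4 skeleton's stub `stub_traceMonotonicity`); nothing asserted. [cite: FackKosaki1986, Lemma 2.5 (iii)] -/
def TraceMonotonicity (G : SimpleGraph V) [G.LocallyFinite] : Prop :=
  ∀ C : ℝ≥0∞, OperatorIRBound G C → ∀ v : V, ∀ p : unitInterval,
    (p : ℝ) < criticalProb G v → triangle G v p ≤ C ^ 3 * rwPolygon 3 G v

/-! ## §2 The `Cay(𝔊^k)`-specific hypothesis shapes (binder repairs b1–b3 of rule :517) and the triangle door -/

/-- **P2 — `UniformPolygons q`**: the lazy random-walk `q`-gon of `Cay(𝔊^k; std)` is finite UNIFORMLY in `k ≥ 1`: `∃ B < ∞, ∀ k ≥ 1, ∀ v, G_q^L(v) ≤ B`.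
Binder repair b1 of the skeleton's parameterless `UniformPolygons` (which reads `∀ q, UniformPolygons q`; its tail consumes `q = 3` only).  A hypothesis shape (the
skeleton's stub `stub_uniformPolygons`, item E4.2; tree inputs: the walk product formula p688765 and the return decay p688051/p689908 modulo the printed Woess fact
p687849); nothing asserted. [cite: HeydenreichVanDerHofstad2017, §5.2 (random-walk diagrams)] [cite: BenjaminiSchramm1996, §2 (Cayley graphs)] -/
def UniformPolygons (q : ℕ) : Prop :=
  ∃ B : ℝ≥0∞, B < ⊤ ∧ ∀ k : ℕ, 1 ≤ k → ∀ v : GPow k, rwPolygon q (gkCay k) v ≤ B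

/-- **P4 — `SmallParam A`, the small parameter**: `p^{(k)}_4(e, e) ≤ A / k²` for the SIMPLE random walk on `Cay(𝔊^k; std)`, all `k ≥ 1`.  Binder repair b2 of the
skeleton's parameterless `SmallParam` (which reads `∃ A, SmallParam A`).  A hypothesis shape (the skeleton's stub `stub_smallParam`, item E4.1, tree-provable from
«GrigorchukPowerSmallParam» p687152 + the product formula p688765); nothing asserted here. [cite: HeydenreichVanDerHofstad2017, §5.2 (random-walk quantities)] [cite: BenjaminiSchramm1996, §2 (Cayley graphs)] -/
def SmallParam (A : ℝ) : Prop :=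
  ∀ k : ℕ, 1 ≤ k → simpleStep (gkCay k) 4 1 1 ≤ A / (k : ℝ) ^ 2

/-- **K1 — `NcHaraSladeGk k₀`, the line crux (perturbative): the non-commutative Hara–Slade theorem on `𝔊^k`** — `1 ≤ k₀ ∧ ∀ k ≥ k₀, OIRB_3(Cay(𝔊^k))`.
Binder repair b3 of the skeleton's parameterless `NcHaraSladeGk` (which reads `∃ k₀, NcHaraSladeGk k₀`).  A statement shape; OPEN — nothing asserted, no proof
on any `Cay(𝔊^k)` exists. [cite: HaraSlade1990, Thm. 1.1 (the commutative ℤ^d statement transplanted)] [cite: HeydenreichVanDerHofstad2017, §8.1 (bootstrap)] -/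
def NcHaraSladeGk (k₀ : ℕ) : Prop :=
  1 ≤ k₀ ∧ ∀ k : ℕ, k₀ ≤ k → OperatorIRBound (gkCay k) 3

/-- **P3 — the TRIANGLE DOOR on `Cay(𝔊^k)`** (a NAMED-FACT-shaped hypothesis of the W4 assembly, never a stub): the triangle condition on the unimodular
transitive `Cay(𝔊^k; std)` gives `θ(p_c) = 0` there, i.e. `gkCay_conj4 k`.  A typed implication between shapes; NOTHING asserted (`gkCay_conj4 k` is
@[conjecture], OPEN). [cite: BarskyAizenman1991, Thm. 1.1] [cite: BenjaminiSchramm1996, Conj. 4] -/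
def TriangleDoorGk (k : ℕ) : Prop := TriangleCond (gkCay k) → gkCay_conj4 k

/-! ## §3 Tiny proved API (junk-safety of the defs) -/

/-- `τ_p` is symmetric: `τ_p(x, y) = τ_p(y, x)` (reachability in the open graph is symmetric). [cite: HeydenreichVanDerHofstad2017, §1.1] -/
theorem conn_comm (G : SimpleGraph V) (p : unitInterval) (x y : V) : conn G p x y = conn G p y x := by
  unfold conn
  congr 1
  ext ω
  exact ⟨fun h => SimpleGraph.Reachable.symm h, fun h => SimpleGraph.Reachable.symm h⟩

/-- `0 ≤ τ_p(x, y)`. [cite: HeydenreichVanDerHofstad2017, §1.1] -/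
theorem conn_nonneg (G : SimpleGraph V) (p : unitInterval) (x y : V) : 0 ≤ conn G p x y := measureReal_nonneg

/-- `τ_p(x, y) ≤ 1`. [cite: HeydenreichVanDerHofstad2017, §1.1] -/
theorem conn_le_one (G : SimpleGraph V) (p : unitInterval) (x y : V) : conn G p x y ≤ 1 := measureReal_le_one

/-- `τ_p(x, x) = 1`. [cite: HeydenreichVanDerHofstad2017, §1.1] -/
theorem conn_self (G : SimpleGraph V) (p : unitInterval) (x : V) : conn G p x x = 1 := by
  unfold conn
  rw [show {ω : BondConfig V | x ∈ openCluster ω x} = Set.univ from Set.eq_univ_of_forall fun ω => mem_openCluster_self ω x, probReal_univ]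

/-- The lazy walk at time `0` is the identity kernel. [folklore] -/
@[simp] theorem lazyStep_zero (G : SimpleGraph V) [G.LocallyFinite] (x y : V) : lazyStep G 0 x y = if x = y then 1 else 0 := rfl

/-- The simple walk at time `0` is the identity kernel. [folklore] -/
@[simp] theorem simpleStep_zero (G : SimpleGraph V) [G.LocallyFinite] (x y : V) : simpleStep G 0 x y = if x = y then 1 else 0 := rfl

/-- The lazy walk's one-step recursion. [folklore] -/
theorem lazyStep_succ (G : SimpleGraph V) [G.LocallyFinite] (n : ℕ) (x y : V) :
    lazyStep G (n + 1) x y = (1 / 2 : ℝ) * lazyStep G n x y + (1 / 2 : ℝ) * ∑ z ∈ G.neighborFinset x, (1 / (G.degree x : ℝ)) * lazyStep G n z y := rfl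

/-- The simple walk's one-step recursion. [folklore] -/
theorem simpleStep_succ (G : SimpleGraph V) [G.LocallyFinite] (n : ℕ) (x y : V) :
    simpleStep G (n + 1) x y = ∑ z ∈ G.neighborFinset x, (1 / (G.degree x : ℝ)) * simpleStep G n z y := rfl

end NcHaraSlade

end Grigorchuk

end Summit.CriticalPhenomena.PercolationContinuityZ3.Theorems.Transplant

end
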